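import Literature.Barriers.Parity.LinearSieveOptimalityBuchstab
import Literature.NumberTheory.LFunctions.MertensConstant
import Mathlib.Analysis.SpecialFunctions.Integrals.Basic
import Mathlib.Topology.UniformSpace.HeineCantor
import HarnessLib

/-!
# `LinearSieveOptimality` — companion file: prime sums against `1/p` as Riemann sums

Topic `Literature/Barriers/Parity`, companion of the catalogue entry `LinearSieveOptimality.lean`
(Selberg's extremal examples for the linear sieve, Greaves 2001 §4.5.1). The ANALYTIC tool of the
Buchstab induction proving Greaves' Theorem 4.5.1.1 is "partial summation" (Greaves §4.1.2,
Lemma 4.1.2): sums `∑_{X^{1/σ} ≤ p < X^{1/s}} (1/p) h(log X/log p)` over primes are Riemann–Stieltjes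
sums against `d(∑_{p<y} 1/p) ≈ d log log y`, i.e. against `dt/t` in the variable
`t = log X/log p`. Everything here is PROVED (no definitions, no named facts):

* `tendsto_sum_primesBelow_inv_sub_loglog` — Mertens' second theorem for the primes STRICTLY
  below `y`: `∑_{p < y} 1/p − log log y → B₁` (from the tree's `∑_{p ≤ x}` version,
  `Literature.NumberTheory.LFunctions.Mertens.tendsto_primeRecipSum_sub_loglog`; the two sums
  differ by at most `1/⌊y⌋`);
* `tendsto_sum_primesBelow_rpow_inv_sub_loglog` — `∑_{p < X^{1/t}} 1/p − log log X → B₁ − log t`;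
* `tendsto_sum_primes_inv_mul_of_continuousOn` — for `0 < s < σ` and `h` continuous on `[s, σ]`,
  `∑_{X^{1/σ} ≤ p < X^{1/s}} (1/p) h(log X/log p) → ∫_s^σ h(t) dt/t` as `X → ∞` (Riemann sums over
  the blocks `X^{1/t_{i+1}} ≤ p < X^{1/t_i}` of an equipartition `t_i` of `[s, σ]`, uniform
  continuity of `h`, and the block masses `∑ 1/p → log(t_{i+1}/t_i) = ∫_{t_i}^{t_{i+1}} dt/t`).

## References

* G. Greaves, *Sieves in Number Theory*, Springer (2001), §4.1.2 Lemma 2 and §4.5.1 (1.16)–(1.17)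
  [Greaves2001].
* G. H. Hardy, E. M. Wright, *An Introduction to the Theory of Numbers*, Thm 427 (Mertens'
  second theorem) [HardyWright2008].
-/

noncomputable section

open Filter Finset
open scoped Topology

namespace Literature.Barriers.Parity

open Literature.NumberTheory.LFunctions.Mertens (primeRecipSum meisselMertens
  tendsto_primeRecipSum_sub_loglog)

/-! ### A `Tendsto` criterion -/

/-- If for every `ε > 0` eventually `|f(x) − L| ≤ K ε` (fixed `K`), then `f → L`. [folklore] -/
theorem tendsto_of_forall_eventually_abs_sub_le {f : ℝ → ℝ} {L K : ℝ}
    (h : ∀ ε : ℝ, 0 < ε → ∀ᶠ x in atTop, |f x - L| ≤ K * ε) : Tendsto f atTop (𝓝 L) := by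
  rw [Metric.tendsto_nhds]
  intro ε hε
  have hK : 0 < |K| + 1 := by positivity
  filter_upwards [h (ε / (2 * (|K| + 1))) (by positivity)] with x hx
  rw [Real.dist_eq]
  have hε' : 0 ≤ ε / (2 * (|K| + 1)) := by positivity
  calc |f x - L| ≤ K * (ε / (2 * (|K| + 1))) := hx
    _ ≤ |K| * (ε / (2 * (|K| + 1))) := mul_le_mul_of_nonneg_right (le_abs_self K) hε'
    _ = ε * (|K| / (2 * (|K| + 1))) := by ring
    _ < ε * 1 := by
        refine mul_lt_mul_of_pos_left ?_ hε
        rw [div_lt_one (by positivity)]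
        linarith [abs_nonneg K]
    _ = ε := mul_one ε

/-! ### Mertens' second theorem for the primes below `y` -/

/-- `{p < y} ⊆ {p ≤ y}` as `primesBelow ⌈y⌉ ⊆ primesLE ⌊y⌋`. [folklore] -/
theorem primesBelow_ceil_subset_primesLE_floor (y : ℝ) :
    Nat.primesBelow ⌈y⌉₊ ⊆ Nat.primesLE ⌊y⌋₊ := by
  intro p hp
  rw [Nat.mem_primesBelow] at hp
  show p ∈ Nat.primesBelow (⌊y⌋₊ + 1)
  rw [Nat.mem_primesBelow]
  exact ⟨Nat.lt_succ_of_le (Nat.le_floor (Nat.lt_ceil.mp hp.1).le), hp.2⟩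

/-- `{p ≤ y} ∖ {p < y} ⊆ {⌊y⌋}`. [folklore] -/
theorem primesLE_floor_sdiff_subset {y : ℝ} (hy : 0 ≤ y) :
    Nat.primesLE ⌊y⌋₊ \ Nat.primesBelow ⌈y⌉₊ ⊆ {⌊y⌋₊} := by
  intro p hp
  rw [Finset.mem_sdiff] at hp
  obtain ⟨h1, h2⟩ := hp
  change p ∈ Nat.primesBelow (⌊y⌋₊ + 1) at h1
  rw [Nat.mem_primesBelow] at h1 h2
  rw [mem_singleton]
  have hple : p ≤ ⌊y⌋₊ := Nat.lt_succ_iff.mp h1.1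
  have hnot : ¬ (p : ℝ) < y := fun hlt => h2 ⟨Nat.lt_ceil.mpr hlt, h1.2⟩
  have : (⌊y⌋₊ : ℝ) ≤ p := (Nat.floor_le hy).trans (not_lt.mp hnot)
  exact le_antisymm hple (by exact_mod_cast this)

/-- **Mertens' second theorem for `∑_{p < y} 1/p`**: `∑_{p < y} 1/p − log log y → B₁` (the
Meissel–Mertens constant), from the tree's `∑_{p ≤ y}` form: the two sums differ by `0` or
`1/⌊y⌋`. [cite: HardyWright2008, Thm 428 (§22.8)] -/
theorem tendsto_sum_primesBelow_inv_sub_loglog :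
    Tendsto (fun y : ℝ => ∑ p ∈ Nat.primesBelow ⌈y⌉₊, (p : ℝ)⁻¹ - Real.log (Real.log y)) atTop
      (𝓝 meisselMertens) := by
  have hdiff : Tendsto (fun y : ℝ => primeRecipSum y - ∑ p ∈ Nat.primesBelow ⌈y⌉₊, (p : ℝ)⁻¹)
      atTop (𝓝 0) := by
    have hsub1 : Tendsto (fun y : ℝ => y - 1) atTop atTop :=
      tendsto_atTop_atTop.mpr fun b => ⟨b + 1, fun y hy => by linarith⟩
    have hup : Tendsto (fun y : ℝ => (y - 1)⁻¹) atTop (𝓝 0) := tendsto_inv_atTop_zero.comp hsub1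
    refine squeeze_zero' ?_ ?_ hup
    · filter_upwards [eventually_ge_atTop 0] with y hy
      rw [primeRecipSum, sub_nonneg]
      exact sum_le_sum_of_subset_of_nonneg (primesBelow_ceil_subset_primesLE_floor y)
        fun p _ _ => inv_nonneg.mpr (Nat.cast_nonneg p)
    · filter_upwards [eventually_gt_atTop 1] with y hy
      rw [primeRecipSum, ← sum_sdiff_eq_sub (primesBelow_ceil_subset_primesLE_floor y)]
      calc ∑ p ∈ Nat.primesLE ⌊y⌋₊ \ Nat.primesBelow ⌈y⌉₊, (p : ℝ)⁻¹
          ≤ ∑ p ∈ ({⌊y⌋₊} : Finset ℕ), (p : ℝ)⁻¹ :=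
            sum_le_sum_of_subset_of_nonneg (primesLE_floor_sdiff_subset (by linarith))
              fun p _ _ => inv_nonneg.mpr (Nat.cast_nonneg p)
        _ = ((⌊y⌋₊ : ℕ) : ℝ)⁻¹ := sum_singleton _ _
        _ ≤ (y - 1)⁻¹ := by
            have h1 : y - 1 < ⌊y⌋₊ := Nat.sub_one_lt_floor y
            exact inv_anti₀ (by linarith) h1.le
  have h := tendsto_primeRecipSum_sub_loglog.sub hdiff
  rw [sub_zero] at h
  refine h.congr' (Eventually.of_forall fun y => ?_)
  ring

/-- `∑_{p < X^{1/t}} 1/p − log log X → B₁ − log t` for fixed `t > 0`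
(`log log X^{1/t} = log log X − log t`). [cite: HardyWright2008, Thm 428 (§22.8)] -/
theorem tendsto_sum_primesBelow_rpow_inv_sub_loglog {t : ℝ} (ht : 0 < t) :
    Tendsto (fun X : ℝ => ∑ p ∈ Nat.primesBelow ⌈X ^ (1 / t)⌉₊, (p : ℝ)⁻¹ - Real.log (Real.log X))
      atTop (𝓝 (meisselMertens - Real.log t)) := by
  have h1 := tendsto_sum_primesBelow_inv_sub_loglog.comp (tendsto_rpow_atTop (one_div_pos.mpr ht))
  have h2 := h1.sub_const (Real.log t)
  refine h2.congr' ?_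
  filter_upwards [eventually_gt_atTop 1] with X hX
  have hlog : 0 < Real.log X := Real.log_pos hX
  simp only [Function.comp_apply]
  rw [Real.log_rpow (by linarith), one_div, inv_mul_eq_div, Real.log_div hlog.ne' ht.ne']
  ring

/-! ### The blocks `X^{1/b} ≤ p < X^{1/a}` -/

/-- For `X > 1`, `0 < a ≤ b` and a prime `p` with `X^{1/b} ≤ p < X^{1/a}`:
`a < log X/log p ≤ b`. [folklore] -/
theorem div_log_mem_of_mem_block {X a b : ℝ} (hX : 1 < X) (ha : 0 < a) (hab : a ≤ b) {p : ℕ}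
    (hp : p.Prime) (h1 : X ^ (1 / b) ≤ (p : ℝ)) (h2 : (p : ℝ) < X ^ (1 / a)) :
    a < Real.log X / Real.log p ∧ Real.log X / Real.log p ≤ b := by
  have hX0 : 0 < X := by linarith
  have hp2 : (2 : ℝ) ≤ p := by exact_mod_cast hp.two_le
  have hlogp : 0 < Real.log p := Real.log_pos (by linarith)
  have hb : 0 < b := ha.trans_le hab
  constructor
  · have h : Real.log p < Real.log X / a := by
      have := Real.log_lt_log (by linarith) h2
      rwa [Real.log_rpow hX0, one_div, inv_mul_eq_div] at this
    rw [lt_div_iff₀ hlogp]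
    rw [lt_div_iff₀ ha] at h
    linarith [mul_comm a (Real.log p)]
  · have h : Real.log X / b ≤ Real.log p := by
      have := Real.log_le_log (Real.rpow_pos_of_pos hX0 _) h1
      rwa [Real.log_rpow hX0, one_div, inv_mul_eq_div] at this
    rw [div_le_iff₀ hlogp]
    rw [div_le_iff₀ hb] at h
    linarith [mul_comm b (Real.log p)]

/-- Monotonicity of the cumulative prime sets: for `X ≥ 1` and `0 < a ≤ b`,
`{p < X^{1/b}} ⊆ {p < X^{1/a}}`. [folklore] -/
theorem primesBelow_rpow_subset {X a b : ℝ} (hX : 1 ≤ X) (ha : 0 < a) (hab : a ≤ b) :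
    Nat.primesBelow ⌈X ^ (1 / b)⌉₊ ⊆ Nat.primesBelow ⌈X ^ (1 / a)⌉₊ := by
  intro p hp
  rw [Nat.mem_primesBelow] at hp ⊢
  refine ⟨hp.1.trans_le (Nat.ceil_mono ?_), hp.2⟩
  exact Real.rpow_le_rpow_of_exponent_le hX (one_div_le_one_div_of_le ha hab)

/-! ### Prime sums against `1/p` as Riemann sums -/

/-- **Partial summation against `d(∑_{p<y} 1/p)`** (the `ρ ≡ 1` case of Greaves' Lemma 4.1.2, in
qualitative form): for `0 < s < σ` and `h` continuous on `[s, σ]`,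
`∑_{X^{1/σ} ≤ p < X^{1/s}} (1/p) h(log X/log p) → ∫_s^σ h(t) dt/t` as `X → ∞`.
Proof: split `[s, σ]` into `n` equal parts `t_i`; on the block `X^{1/t_{i+1}} ≤ p < X^{1/t_i}` one
has `t_i < log X/log p ≤ t_{i+1}`, so `h(log X/log p) = h(t_i) + O(ε)` by uniform continuity, while
the block mass `∑ 1/p → log(t_{i+1}/t_i) = ∫_{t_i}^{t_{i+1}} dt/t` (Mertens); finally
`|∑_i h(t_i) log(t_{i+1}/t_i) − ∫_s^σ h/t| ≤ ε (σ − s)/s`. [cite: Greaves2001, §4.1.2 Lemma 2] -/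
theorem tendsto_sum_primes_inv_mul_of_continuousOn {s σ : ℝ} (hs : 0 < s) (hsσ : s < σ)
    {h : ℝ → ℝ} (hh : ContinuousOn h (Set.Icc s σ)) :
    Tendsto (fun X : ℝ =>
      ∑ p ∈ (Nat.primesBelow ⌈X ^ (1 / s)⌉₊).filter (fun p : ℕ => X ^ (1 / σ) ≤ (p : ℝ)),
        (p : ℝ)⁻¹ * h (Real.log X / Real.log p)) atTop (𝓝 (∫ u in s..σ, h u / u)) := by
  have hσ : 0 < σ := hs.trans hsσ
  -- cumulative sums
  set A : ℝ → ℝ → ℝ := fun t X => ∑ p ∈ Nat.primesBelow ⌈X ^ (1 / t)⌉₊, (p : ℝ)⁻¹ with hA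
  set Ah : ℝ → ℝ → ℝ := fun t X =>
    ∑ p ∈ Nat.primesBelow ⌈X ^ (1 / t)⌉₊, (p : ℝ)⁻¹ * h (Real.log X / Real.log p) with hAh
  set K : ℝ := (Real.log σ - Real.log s + 1) + 1 + (σ - s) / s with hK
  refine tendsto_of_forall_eventually_abs_sub_le (K := K) fun ε hε => ?_
  -- uniform continuity of `h`
  obtain ⟨δ, hδ, hUC⟩ := Metric.uniformContinuousOn_iff_le.mp
    (isCompact_Icc.uniformContinuousOn_of_continuous hh) ε hε
  -- the grid `t i = s + i Δ`, `Δ = (σ - s)/n ≤ δ`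
  obtain ⟨n, hn1, hnδ⟩ : ∃ n : ℕ, 1 ≤ n ∧ (σ - s) / n ≤ δ := by
    refine ⟨⌈(σ - s) / δ⌉₊ + 1, by omega, ?_⟩
    have h1 : (σ - s) / δ ≤ ⌈(σ - s) / δ⌉₊ := Nat.le_ceil _
    rw [div_le_iff₀ hδ] at h1
    rw [div_le_iff₀ (by positivity)]
    push_cast
    nlinarith
  have hn0 : (0 : ℝ) < n := by exact_mod_cast hn1
  set Δ : ℝ := (σ - s) / n with hΔ
  have hΔ0 : 0 < Δ := div_pos (by linarith) hn0
  have hnΔ : (n : ℝ) * Δ = σ - s := by rw [hΔ]; field_simp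
  set t : ℕ → ℝ := fun i => s + i * Δ with htdef
  have ht0 : t 0 = s := by simp [htdef]
  have htn : t n = σ := by simp only [htdef]; linarith
  have htsucc : ∀ i : ℕ, t (i + 1) - t i = Δ := fun i => by simp only [htdef]; push_cast; ring
  have htsucc' : ∀ i : ℕ, t i ≤ t (i + 1) := fun i => by linarith [htsucc i]
  have htmono : ∀ i j : ℕ, i ≤ j → t i ≤ t j := fun i j hij => by
    simp only [htdef]
    have : (i : ℝ) ≤ j := by exact_mod_cast hij
    nlinarith
  have hts : ∀ i : ℕ, s ≤ t i := fun i => by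
    simp only [htdef]
    have : (0 : ℝ) ≤ i := Nat.cast_nonneg i
    nlinarith
  have htσ : ∀ i : ℕ, i ≤ n → t i ≤ σ := fun i hi => htn ▸ htmono i n hi
  have htpos : ∀ i : ℕ, 0 < t i := fun i => hs.trans_le (hts i)
  -- limits of the block masses `ν_i(X) = A (t i) X - A (t (i+1)) X → log t_{i+1} - log t_i`
  have hν : ∀ i : ℕ, Tendsto (fun X => A (t i) X - A (t (i + 1)) X) atTop
      (𝓝 (Real.log (t (i + 1)) - Real.log (t i))) := by
    intro i
    have h12 := (tendsto_sum_primesBelow_rpow_inv_sub_loglog (htpos i)).sub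
      (tendsto_sum_primesBelow_rpow_inv_sub_loglog (htpos (i + 1)))
    rw [show meisselMertens - Real.log (t i) - (meisselMertens - Real.log (t (i + 1))) =
      Real.log (t (i + 1)) - Real.log (t i) by ring] at h12
    exact h12.congr fun X => by simp only [hA]; ring
  -- (E1) the Riemann sums against the block masses converge
  have hE1 : ∀ᶠ X in atTop, |∑ i ∈ range n, h (t i) * (A (t i) X - A (t (i + 1)) X) -
      ∑ i ∈ range n, h (t i) * (Real.log (t (i + 1)) - Real.log (t i))| ≤ ε := by
    have hlim : Tendsto (fun X => ∑ i ∈ range n, h (t i) * (A (t i) X - A (t (i + 1)) X)) atTop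
        (𝓝 (∑ i ∈ range n, h (t i) * (Real.log (t (i + 1)) - Real.log (t i)))) :=
      tendsto_finsetSum _ fun i _ => (hν i).const_mul _
    filter_upwards [(Metric.tendsto_nhds.mp hlim) ε hε] with X hX
    rw [Real.dist_eq] at hX
    exact hX.le
  -- (E2) the total mass stays bounded
  have hE2 : ∀ᶠ X in atTop, ∑ i ∈ range n, (A (t i) X - A (t (i + 1)) X) ≤
      Real.log σ - Real.log s + 1 := by
    have hlim : Tendsto (fun X => ∑ i ∈ range n, (A (t i) X - A (t (i + 1)) X)) atTop
        (𝓝 (∑ i ∈ range n, (Real.log (t (i + 1)) - Real.log (t i)))) :=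
      tendsto_finsetSum _ fun i _ => hν i
    rw [Finset.sum_range_sub (fun i => Real.log (t i)), htn, ht0] at hlim
    filter_upwards [(tendsto_order.1 hlim).2 _ (lt_add_one _)] with X hX
    exact hX.le
  filter_upwards [hE1, hE2, eventually_gt_atTop (1 : ℝ)] with X hX1 hX2 hX
  -- from here on `X > 1` is fixed
  have hX1' : 1 ≤ X := hX.le
  -- the blocks
  have hsub : ∀ i : ℕ, Nat.primesBelow ⌈X ^ (1 / t (i + 1))⌉₊ ⊆ Nat.primesBelow ⌈X ^ (1 / t i)⌉₊ :=
    fun i => primesBelow_rpow_subset hX1' (htpos i) (htsucc' i)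
  have hblock : ∀ i : ℕ, i < n → ∀ p ∈ Nat.primesBelow ⌈X ^ (1 / t i)⌉₊ \
      Nat.primesBelow ⌈X ^ (1 / t (i + 1))⌉₊,
      0 ≤ (p : ℝ)⁻¹ ∧ |h (Real.log X / Real.log p) - h (t i)| ≤ ε := by
    intro i hi p hp
    rw [Finset.mem_sdiff, Nat.mem_primesBelow, Nat.mem_primesBelow, not_and'] at hp
    obtain ⟨⟨hp1, hpp⟩, hp2⟩ := hp
    have hlt : (p : ℝ) < X ^ (1 / t i) := Nat.lt_ceil.mp hp1
    have hge : X ^ (1 / t (i + 1)) ≤ (p : ℝ) := Nat.ceil_le.mp (not_lt.mp (hp2 hpp))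
    obtain ⟨hl, hu⟩ := div_log_mem_of_mem_block hX (htpos i) (htsucc' i) hpp hge hlt
    refine ⟨inv_nonneg.mpr (Nat.cast_nonneg p), ?_⟩
    have hmem : Real.log X / Real.log p ∈ Set.Icc s σ :=
      ⟨(hts i).trans hl.le, hu.trans (htσ (i + 1) hi)⟩
    have hti : t i ∈ Set.Icc s σ := ⟨hts i, htσ i hi.le⟩
    have hdist : dist (Real.log X / Real.log p) (t i) ≤ δ := by
      rw [Real.dist_eq, abs_of_pos (by linarith)]
      linarith [htsucc i]
    have := hUC _ hmem _ hti hdist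
    rwa [Real.dist_eq] at this
  -- (1) the sum as a sum over blocks
  have hSum : ∑ p ∈ (Nat.primesBelow ⌈X ^ (1 / s)⌉₊).filter (fun p : ℕ => X ^ (1 / σ) ≤ (p : ℝ)),
      (p : ℝ)⁻¹ * h (Real.log X / Real.log p) =
      ∑ i ∈ range n, ∑ p ∈ Nat.primesBelow ⌈X ^ (1 / t i)⌉₊ \ Nat.primesBelow ⌈X ^ (1 / t (i + 1))⌉₊,
        (p : ℝ)⁻¹ * h (Real.log X / Real.log p) := by
    have h1 : ∑ p ∈ (Nat.primesBelow ⌈X ^ (1 / s)⌉₊).filter (fun p : ℕ => X ^ (1 / σ) ≤ (p : ℝ)),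
        (p : ℝ)⁻¹ * h (Real.log X / Real.log p) = Ah (t 0) X - Ah (t n) X := by
      rw [← primesBelow_sdiff_eq_filter, sum_sdiff_eq_sub (primesBelow_rpow_subset hX1' hs hsσ.le),
        ht0, htn]
    rw [h1, ← Finset.sum_range_sub' (fun i => Ah (t i) X) n]
    refine sum_congr rfl fun i _ => ?_
    rw [sum_sdiff_eq_sub (hsub i)]
  -- (2) the block masses
  have hMass : ∀ i : ℕ, ∑ p ∈ Nat.primesBelow ⌈X ^ (1 / t i)⌉₊ \ Nat.primesBelow ⌈X ^ (1 / t (i + 1))⌉₊,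
      (p : ℝ)⁻¹ = A (t i) X - A (t (i + 1)) X := fun i => by
    rw [sum_sdiff_eq_sub (hsub i)]
  -- (3) comparison of the sum with the Riemann–Stieltjes sum `∑ h(t_i) ν_i`
  have h3 : |∑ p ∈ (Nat.primesBelow ⌈X ^ (1 / s)⌉₊).filter (fun p : ℕ => X ^ (1 / σ) ≤ (p : ℝ)),
      (p : ℝ)⁻¹ * h (Real.log X / Real.log p) -
      ∑ i ∈ range n, h (t i) * (A (t i) X - A (t (i + 1)) X)| ≤
      ε * (Real.log σ - Real.log s + 1) := by
    rw [hSum, ← sum_sub_distrib]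
    calc |∑ i ∈ range n, (∑ p ∈ Nat.primesBelow ⌈X ^ (1 / t i)⌉₊ \
            Nat.primesBelow ⌈X ^ (1 / t (i + 1))⌉₊, (p : ℝ)⁻¹ * h (Real.log X / Real.log p) -
            h (t i) * (A (t i) X - A (t (i + 1)) X))|
        ≤ ∑ i ∈ range n, |∑ p ∈ Nat.primesBelow ⌈X ^ (1 / t i)⌉₊ \
            Nat.primesBelow ⌈X ^ (1 / t (i + 1))⌉₊, (p : ℝ)⁻¹ * h (Real.log X / Real.log p) -
            h (t i) * (A (t i) X - A (t (i + 1)) X)| := abs_sum_le_sum_abs _ _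
      _ ≤ ∑ i ∈ range n, ε * (A (t i) X - A (t (i + 1)) X) := by
          refine sum_le_sum fun i hi => ?_
          rw [mem_range] at hi
          rw [← hMass i, mul_sum, mul_sum, ← sum_sub_distrib]
          calc |∑ p ∈ Nat.primesBelow ⌈X ^ (1 / t i)⌉₊ \ Nat.primesBelow ⌈X ^ (1 / t (i + 1))⌉₊,
                ((p : ℝ)⁻¹ * h (Real.log X / Real.log p) - h (t i) * (p : ℝ)⁻¹)|
              ≤ ∑ p ∈ Nat.primesBelow ⌈X ^ (1 / t i)⌉₊ \ Nat.primesBelow ⌈X ^ (1 / t (i + 1))⌉₊,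
                |(p : ℝ)⁻¹ * h (Real.log X / Real.log p) - h (t i) * (p : ℝ)⁻¹| :=
                abs_sum_le_sum_abs _ _
            _ ≤ ∑ p ∈ Nat.primesBelow ⌈X ^ (1 / t i)⌉₊ \ Nat.primesBelow ⌈X ^ (1 / t (i + 1))⌉₊,
                ε * (p : ℝ)⁻¹ := by
                refine sum_le_sum fun p hp => ?_
                obtain ⟨hp0, hpε⟩ := hblock i hi p hp
                rw [show (p : ℝ)⁻¹ * h (Real.log X / Real.log p) - h (t i) * (p : ℝ)⁻¹ =
                  (p : ℝ)⁻¹ * (h (Real.log X / Real.log p) - h (t i)) by ring, abs_mul,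
                  abs_of_nonneg hp0, mul_comm]
                exact mul_le_mul_of_nonneg_right hpε hp0
      _ = ε * ∑ i ∈ range n, (A (t i) X - A (t (i + 1)) X) := by rw [mul_sum]
      _ ≤ ε * (Real.log σ - Real.log s + 1) := mul_le_mul_of_nonneg_left hX2 hε.le
  -- (4) the Riemann sum `∑ h(t_i) log(t_{i+1}/t_i)` against the integral
  have hcont : ContinuousOn (fun u => h u / u) (Set.Icc s σ) :=
    hh.div continuousOn_id fun u hu => (hs.trans_le hu.1).ne'
  have hint : ∀ i : ℕ, i < n → IntervalIntegrable (fun u => h u / u) MeasureTheory.volume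
      (t i) (t (i + 1)) := by
    intro i hi
    refine (hcont.mono ?_).intervalIntegrable
    rw [Set.uIcc_of_le (htsucc' i)]
    exact Set.Icc_subset_Icc (hts i) (htσ (i + 1) hi)
  have hI : ∫ u in s..σ, h u / u = ∑ i ∈ range n, ∫ u in t i..t (i + 1), h u / u := by
    rw [intervalIntegral.sum_integral_adjacent_intervals hint, ht0, htn]
  have h4 : |∑ i ∈ range n, h (t i) * (Real.log (t (i + 1)) - Real.log (t i)) -
      ∫ u in s..σ, h u / u| ≤ ε * ((σ - s) / s) := by
    rw [hI, ← sum_sub_distrib]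
    calc |∑ i ∈ range n, (h (t i) * (Real.log (t (i + 1)) - Real.log (t i)) -
            ∫ u in t i..t (i + 1), h u / u)|
        ≤ ∑ i ∈ range n, |h (t i) * (Real.log (t (i + 1)) - Real.log (t i)) -
            ∫ u in t i..t (i + 1), h u / u| := abs_sum_le_sum_abs _ _
      _ ≤ ∑ i ∈ range n, ε / s * Δ := by
          refine sum_le_sum fun i hi => ?_
          rw [mem_range] at hi
          have hti0 : 0 < t i := htpos i
          have h0 : (0 : ℝ) ∉ Set.uIcc (t i) (t (i + 1)) := by
            rw [Set.uIcc_of_le (htsucc' i)]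
            intro h0
            exact absurd h0.1 (not_le.mpr hti0)
          -- `h(t_i) log(t_{i+1}/t_i) = ∫ h(t_i)/u`
          have hconst : h (t i) * (Real.log (t (i + 1)) - Real.log (t i)) =
              ∫ u in t i..t (i + 1), h (t i) * u⁻¹ := by
            rw [intervalIntegral.integral_const_mul, integral_inv h0,
              Real.log_div (htpos (i + 1)).ne' hti0.ne']
          have hint2 : IntervalIntegrable (fun u => h (t i) * u⁻¹) MeasureTheory.volume
              (t i) (t (i + 1)) := by
            refine (ContinuousOn.intervalIntegrable ?_)
            refine continuousOn_const.mul (continuousOn_inv₀.mono ?_)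
            intro u hu
            rw [Set.uIcc_of_le (htsucc' i)] at hu
            exact (hti0.trans_le hu.1).ne'
          rw [hconst, ← intervalIntegral.integral_sub hint2 (hint i hi)]
          have hbound : ∀ u ∈ Set.uIoc (t i) (t (i + 1)),
              ‖h (t i) * u⁻¹ - h u / u‖ ≤ ε / s := by
            intro u hu
            rw [Set.uIoc_of_le (htsucc' i)] at hu
            have hus : s ≤ u := (hts i).trans hu.1.le
            have hu0 : 0 < u := hs.trans_le hus
            have hmem : u ∈ Set.Icc s σ := ⟨hus, hu.2.trans (htσ (i + 1) hi)⟩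
            have hti : t i ∈ Set.Icc s σ := ⟨hts i, htσ i hi.le⟩
            have hdist : dist u (t i) ≤ δ := by
              rw [Real.dist_eq, abs_of_pos (by linarith [hu.1])]
              linarith [htsucc i, hu.2]
            have hε' := hUC u hmem (t i) hti hdist
            rw [Real.dist_eq] at hε'
            rw [Real.norm_eq_abs, show h (t i) * u⁻¹ - h u / u = (h (t i) - h u) * u⁻¹ by ring,
              abs_mul, abs_of_pos (inv_pos.mpr hu0), div_eq_mul_inv, abs_sub_comm]
            exact mul_le_mul hε' (inv_anti₀ hs hus) (inv_pos.mpr hu0).le hε.le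
          have := intervalIntegral.norm_integral_le_of_norm_le_const hbound
          rw [Real.norm_eq_abs, htsucc i, abs_of_pos hΔ0] at this
          exact this
      _ = ε * ((σ - s) / s) := by
          rw [sum_const, card_range, nsmul_eq_mul]
          rw [show (n : ℝ) * (ε / s * Δ) = ε / s * (n * Δ) by ring, hnΔ]
          ring
  -- (5) assemble
  calc |∑ p ∈ (Nat.primesBelow ⌈X ^ (1 / s)⌉₊).filter (fun p : ℕ => X ^ (1 / σ) ≤ (p : ℝ)),
        (p : ℝ)⁻¹ * h (Real.log X / Real.log p) - ∫ u in s..σ, h u / u|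
      = |(∑ p ∈ (Nat.primesBelow ⌈X ^ (1 / s)⌉₊).filter (fun p : ℕ => X ^ (1 / σ) ≤ (p : ℝ)),
          (p : ℝ)⁻¹ * h (Real.log X / Real.log p) -
          ∑ i ∈ range n, h (t i) * (A (t i) X - A (t (i + 1)) X)) +
        (∑ i ∈ range n, h (t i) * (A (t i) X - A (t (i + 1)) X) -
          ∑ i ∈ range n, h (t i) * (Real.log (t (i + 1)) - Real.log (t i))) +
        (∑ i ∈ range n, h (t i) * (Real.log (t (i + 1)) - Real.log (t i)) -
          ∫ u in s..σ, h u / u)| := by ring_nf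
    _ ≤ |∑ p ∈ (Nat.primesBelow ⌈X ^ (1 / s)⌉₊).filter (fun p : ℕ => X ^ (1 / σ) ≤ (p : ℝ)),
          (p : ℝ)⁻¹ * h (Real.log X / Real.log p) -
          ∑ i ∈ range n, h (t i) * (A (t i) X - A (t (i + 1)) X)| +
        |∑ i ∈ range n, h (t i) * (A (t i) X - A (t (i + 1)) X) -
          ∑ i ∈ range n, h (t i) * (Real.log (t (i + 1)) - Real.log (t i))| +
        |∑ i ∈ range n, h (t i) * (Real.log (t (i + 1)) - Real.log (t i)) -
          ∫ u in s..σ, h u / u| := abs_add_three _ _ _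
    _ ≤ ε * (Real.log σ - Real.log s + 1) + ε + ε * ((σ - s) / s) := add_le_add_three h3 hX1 h4
    _ = K * ε := by rw [hK]; ring

end Literature.Barriers.Parity
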